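import Summits.AtomisticToContinuum.FouriersLaw.Theorems.PuiseuxTransferLedgerTwoModeBulkReduction

/-!
# Strategist sketch s2 (cstrat stmt-AtomisticToContinuum-12111, crux `PuiseuxTransferLedger.TwoModeBulk`)

Signatures quoted in `STRATEGY-CENSUS.md` (s2 additions), elaborated so the census quotes only well-typed statements.
Nothing is asserted: every `def … : Prop` is a candidate statement; the one `theorem` is the lossless split glue
(the landed rider, by name) against the children EXACTLY as filed in `children.json` (kuboIntegrand unfolded).
Self-contained copy of the s1 vocabulary (`profileU`, `conductanceG`) so that this file does not import a crux workfile.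
-/

noncomputable section

namespace Summit.AtomisticToContinuum.FouriersLaw.Cruxes.TwoModeBulk.StrategistS2

open MeasureTheory Filter Set
open Literature.MathematicalPhysics.KineticTheory.HeatConduction
open Summit.AtomisticToContinuum.FouriersLaw.Theorems.BoundaryKubo.Negative.LoadBearing (kuboIntegrand)

/-- `u_N(i) = (γ/T²)∫₀^∞ Cov_(μ₀)(p_0², K_t p_i²) dt − 1/2` (explicit equilibrium Kubo profile of the `(N+1)`-site chain). -/
def profileU (ω₂ lam β γ T : ℝ) (N : ℕ) (i : Fin (N + 1)) : ℝ :=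
  γ / T ^ 2 * (∫ t in Set.Ioi (0 : ℝ),
    ((∫ z, (z.2 0) ^ 2 * (∫ y, (y.2 i) ^ 2 ∂((pinnedChain ω₂ lam β γ).transitionKernel (N + 1) T T t.toNNReal z))
        ∂((pinnedChain ω₂ lam β γ).gibbsMeasure (N + 1) T)) -
      (∫ z, (z.2 0) ^ 2 ∂((pinnedChain ω₂ lam β γ).gibbsMeasure (N + 1) T)) *
        (∫ z, (∫ y, (y.2 i) ^ 2 ∂((pinnedChain ω₂ lam β γ).transitionKernel (N + 1) T T t.toNNReal z))
          ∂((pinnedChain ω₂ lam β γ).gibbsMeasure (N + 1) T)))) - 1 / 2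

/-- `g_N = (γ²/T²)∫₀^∞ Cov(p_0², K_t p_N²)` (`= D_(N+1)/N`). -/
def conductanceG (ω₂ lam β γ T : ℝ) (N : ℕ) : ℝ :=
  (γ ^ 2 / T ^ 2) * ∫ t in Set.Ioi (0 : ℝ), kuboIntegrand ω₂ lam β γ T N t

/-- The microscopic TOTAL current observable `J(z) = Σ_b j_b(z)` of the `(N+1)`-site chain. -/
def totalCurrentObs (ω₂ lam β γ : ℝ) (N : ℕ) (z : PhaseSpace (N + 1)) : ℝ :=
  ∑ b : Fin (N + 1), (pinnedChain ω₂ lam β γ).bondCurrent (N + 1) b z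

/-- CORRECTOR PROFILE `W_N(i) := −(1/(N T²)) ∫₀^∞ Cov_(μ₀)(J, K_t p_i²) dt`: the late cooling of site `i` after an
equilibrium fluctuation of the total current (the finite-volume Green–Kubo corrector `(−L*)⁻¹ J` tested against `p_i²`). -/
def correctorW (ω₂ lam β γ T : ℝ) (N : ℕ) (i : Fin (N + 1)) : ℝ :=
  -(1 / ((N : ℝ) * T ^ 2)) * ∫ t in Set.Ioi (0 : ℝ),
    ((∫ z, totalCurrentObs ω₂ lam β γ N z *
        (∫ y, (y.2 i) ^ 2 ∂((pinnedChain ω₂ lam β γ).transitionKernel (N + 1) T T t.toNNReal z))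
        ∂((pinnedChain ω₂ lam β γ).gibbsMeasure (N + 1) T)) -
      (∫ z, totalCurrentObs ω₂ lam β γ N z ∂((pinnedChain ω₂ lam β γ).gibbsMeasure (N + 1) T)) *
        (∫ z, (∫ y, (y.2 i) ^ 2 ∂((pinnedChain ω₂ lam β γ).transitionKernel (N + 1) T T t.toNNReal z))
          ∂((pinnedChain ω₂ lam β γ).gibbsMeasure (N + 1) T)))

/-! ## (★) the corrector identity and the corrector form of the crux (census §Transfer item 9 / §Strengthen S⁺₅) -/

/-- (★) CORRECTOR IDENTITY (exact, every `N ≥ 1`; fixed-`N` Poisson-equation calculus: `p_0² − T = −γ⁻¹(L Ē + J/N)` with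
`Ē = N⁻¹ Σ_k (N − k) e_k`, time reversal `L* = ΘLΘ`, `Cov_(μ₀)(Ē, p_i²) = (N − i)T²/N`): the profile is the PERFECT Ohmic
profile `1/2 − i/N` minus the corrector profile. Provable with the landed TTCF/limit-exchange technology; not filed (support-sized). -/
def CorrectorIdentity : Prop :=
  ∀ ω₂ lam β γ : ℝ, 0 < ω₂ → 0 < lam → 0 < β → 0 < γ → ∀ T : ℝ, 0 < T → ∀ (N : ℕ) (i : Fin (N + 1)), 1 ≤ N →
    profileU ω₂ lam β γ T N i = 1 / 2 - (i.val : ℝ) / N - correctorW ω₂ lam β γ T N i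

/-- S⁺₅ / transfer form: TWO-MODE STRUCTURE OF THE CORRECTOR — bond increments of `W_N` are the constant `r g_N − 1/N`
(`= −g_N ρ_N/N`, `ρ_N = R_N − N r` the total contact resistance) up to exponential contact layers. Given (★) it is
EQUIVALENT to the two-mode profile property, hence to the crux (restatement in a self-averaging observable; no leverage). -/
def CorrectorTwoMode : Prop :=
  ∀ ω₂ lam β γ : ℝ, 0 < ω₂ → 0 < lam → 0 < β → 0 < γ → ∀ T : ℝ, 0 < T → ∃ r θ C : ℝ, 0 ≤ θ ∧ θ < 1 ∧
    ∀ (N : ℕ) (i j : Fin (N + 1)), j.val = i.val + 1 →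
      |correctorW ω₂ lam β γ T N j - correctorW ω₂ lam β γ T N i - (r * conductanceG ω₂ lam β γ T N - 1 / (N : ℝ))| ≤
        C * |conductanceG ω₂ lam β γ T N| * (θ ^ i.val + θ ^ (N - 1 - i.val))

/-! ## S⁺₇ / wuc candidates (census §Strengthen): shape statements WEAKER than the crux -/

/-- N-UNIFORM LOCAL OHM UPPER BOUND ("no bond is a bottleneck"): every single-bond drop of the response profile is `O(g_N)`
uniformly in `N` and the bond. Implied by the crux (`C' = |r| + 2C`); no engine either; recorded as the weakest clean
`N`-uniform consequence found (route-level `wuc` material, not a decomposition piece). -/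
def LocalOhmBound : Prop :=
  ∀ ω₂ lam β γ : ℝ, 0 < ω₂ → 0 < lam → 0 < β → 0 < γ → ∀ T : ℝ, 0 < T → ∃ C : ℝ,
    ∀ (N : ℕ) (i j : Fin (N + 1)), j.val = i.val + 1 →
      |profileU ω₂ lam β γ T N i - profileU ω₂ lam β γ T N j| ≤ C * |conductanceG ω₂ lam β γ T N|

/-- ONE-SIGNED LAYERS (shape rigidity): on the left half the second differences of `u_N` have a constant sign. With
`LocalOhmBound` it gives `Σ_i |Δ²u_N(i)| ≤ 4C|g_N|` (telescoping) — summable SECOND differences, which still allows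
`Σ_i |Δu_N(i) − r g_N| ∼ g_N log N` (layers `c g/i`): it buys neither the summable-layers form nor the crux. -/
def OneSignedLayers : Prop :=
  ∀ ω₂ lam β γ : ℝ, 0 < ω₂ → 0 < lam → 0 < β → 0 < γ → ∀ T : ℝ, 0 < T → ∀ N : ℕ, ∃ s : ℝ, (s = 1 ∨ s = -1) ∧
    ∀ (i j k : Fin (N + 1)), j.val = i.val + 1 → k.val = i.val + 2 → 2 * k.val ≤ N →
      0 ≤ s * (profileU ω₂ lam β γ T N i - 2 * profileU ω₂ lam β γ T N j + profileU ω₂ lam β γ T N k)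

/-! ## Decomposition D1, exactly as filed (children.json): the glue by name -/

/-- child (L) as filed (route-file vocabulary, `kuboIntegrand` unfolded). -/
def LayerRelaxationFiled : Prop :=
  ∀ ω₂ lam β γ : ℝ, 0 < ω₂ → 0 < lam → 0 < β → 0 < γ → ∀ T : ℝ, 0 < T → ∃ θ C : ℝ, 0 ≤ θ ∧ θ < 1 ∧ ∀ (N : ℕ) (i j k : Fin (N + 1)), j.val = i.val + 1 → k.val = i.val + 2 → |(γ / T ^ 2 * (∫ t in Set.Ioi (0 : ℝ), ((∫ z, (z.2 0) ^ 2 * (∫ y, (y.2 i) ^ 2 ∂((Literature.MathematicalPhysics.KineticTheory.HeatConduction.pinnedChain ω₂ lam β γ).transitionKernel (N + 1) T T t.toNNReal z)) ∂((Literature.MathematicalPhysics.KineticTheory.HeatConduction.pinnedChain ω₂ lam β γ).gibbsMeasure (N + 1) T)) - (∫ z, (z.2 0) ^ 2 ∂((Literature.MathematicalPhysics.KineticTheory.HeatConduction.pinnedChain ω₂ lam β γ).gibbsMeasure (N + 1) T)) * (∫ z, (∫ y, (y.2 i) ^ 2 ∂((Literature.MathematicalPhysics.KineticTheory.HeatConduction.pinnedChain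 ω₂ lam β γ).transitionKernel (N + 1) T T t.toNNReal z)) ∂((Literature.MathematicalPhysics.KineticTheory.HeatConduction.pinnedChain ω₂ lam β γ).gibbsMeasure (N + 1) T)))) - 1 / 2) - 2 * (γ / T ^ 2 * (∫ t in Set.Ioi (0 : ℝ), ((∫ z, (z.2 0) ^ 2 * (∫ y, (y.2 j) ^ 2 ∂((Literature.MathematicalPhysics.KineticTheory.HeatConduction.pinnedChain ω₂ lam β γ).transitionKernel (N + 1) T T t.toNNReal z)) ∂((Literature.MathematicalPhysics.KineticTheory.HeatConduction.pinnedChain ω₂ lam β γ).gibbsMeasure (N + 1) T)) - (∫ z, (z.2 0) ^ 2 ∂((Literature.MathematicalPhysics.KineticTheory.HeatConduction.pinnedChain ω₂ lam β γ).gibbsMeasure (N + 1) T)) * (∫ z, (∫ y, (y.2 j) ^ 2 ∂((Literature.MathematicalPhysics.KineticTheory.HeatConduction.pinnedChain ω₂ lam β γ).transitionKernel (N + 1) T T t.toNNReal z)) ∂((Literature.MathematicalPhysics.KineticTheory.HeatConduction.pinnedChain ω₂ lam β γ).gibbsMeasure (N + 1) T)))) - 1 / 2) + (γ / T ^ 2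 * (∫ t in Set.Ioi (0 : ℝ), ((∫ z, (z.2 0) ^ 2 * (∫ y, (y.2 k) ^ 2 ∂((Literature.MathematicalPhysics.KineticTheory.HeatConduction.pinnedChain ω₂ lam β γ).transitionKernel (N + 1) T T t.toNNReal z)) ∂((Literature.MathematicalPhysics.KineticTheory.HeatConduction.pinnedChain ω₂ lam β γ).gibbsMeasure (N + 1) T)) - (∫ z, (z.2 0) ^ 2 ∂((Literature.MathematicalPhysics.KineticTheory.HeatConduction.pinnedChain ω₂ lam β γ).gibbsMeasure (N + 1) T)) * (∫ z, (∫ y, (y.2 k) ^ 2 ∂((Literature.MathematicalPhysics.KineticTheory.HeatConduction.pinnedChain ω₂ lam β γ).transitionKernel (N + 1) T T t.toNNReal z)) ∂((Literature.MathematicalPhysics.KineticTheory.HeatConduction.pinnedChain ω₂ lam β γ).gibbsMeasure (N + 1) T)))) - 1 / 2)| ≤ C * |((γ ^ 2 / T ^ 2) * ∫ t in Set.Ioi (0 : ℝ), ((∫ z, (z.2 0) ^ 2 * (∫ y, (y.2 (Fin.last N)) ^ 2 ∂((Literature.MathematicalPhysics.KineticTheory.HeatConduction.pinnedChain ω₂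 lam β γ).transitionKernel (N + 1) T T t.toNNReal z)) ∂((Literature.MathematicalPhysics.KineticTheory.HeatConduction.pinnedChain ω₂ lam β γ).gibbsMeasure (N + 1) T)) - (∫ z, (z.2 0) ^ 2 ∂((Literature.MathematicalPhysics.KineticTheory.HeatConduction.pinnedChain ω₂ lam β γ).gibbsMeasure (N + 1) T)) * (∫ z, (∫ y, (y.2 (Fin.last N)) ^ 2 ∂((Literature.MathematicalPhysics.KineticTheory.HeatConduction.pinnedChain ω₂ lam β γ).transitionKernel (N + 1) T T t.toNNReal z)) ∂((Literature.MathematicalPhysics.KineticTheory.HeatConduction.pinnedChain ω₂ lam β γ).gibbsMeasure (N + 1) T))))| * (θ ^ i.val + θ ^ (N - 2 - i.val))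

/-- child (B) as filed. -/
def BulkSlopeFiled : Prop :=
  ∀ ω₂ lam β γ : ℝ, 0 < ω₂ → 0 < lam → 0 < β → 0 < γ → ∀ T : ℝ, 0 < T → ∃ r θ C : ℝ, 0 ≤ θ ∧ θ < 1 ∧ ∀ (N : ℕ) (i j : Fin (N + 1)), i.val = N / 2 → j.val = i.val + 1 → |(γ / T ^ 2 * (∫ t in Set.Ioi (0 : ℝ), ((∫ z, (z.2 0) ^ 2 * (∫ y, (y.2 i) ^ 2 ∂((Literature.MathematicalPhysics.KineticTheory.HeatConduction.pinnedChain ω₂ lam β γ).transitionKernel (N + 1) T T t.toNNReal z)) ∂((Literature.MathematicalPhysics.KineticTheory.HeatConduction.pinnedChain ω₂ lam β γ).gibbsMeasure (N + 1) T)) - (∫ z, (z.2 0) ^ 2 ∂((Literature.MathematicalPhysics.KineticTheory.HeatConduction.pinnedChain ω₂ lam β γ).gibbsMeasure (N + 1) T)) * (∫ z, (∫ y, (y.2 i) ^ 2 ∂((Literature.MathematicalPhysics.KineticTheory.HeatConduction.pinnedChain ω₂ lam β γ).transitionKernel (N + 1) T T t.toNNReal z)) ∂((Literature.MathematicalPhysics.KineticTheory.HeatConduction.pinnedChain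 ω₂ lam β γ).gibbsMeasure (N + 1) T)))) - 1 / 2) - (γ / T ^ 2 * (∫ t in Set.Ioi (0 : ℝ), ((∫ z, (z.2 0) ^ 2 * (∫ y, (y.2 j) ^ 2 ∂((Literature.MathematicalPhysics.KineticTheory.HeatConduction.pinnedChain ω₂ lam β γ).transitionKernel (N + 1) T T t.toNNReal z)) ∂((Literature.MathematicalPhysics.KineticTheory.HeatConduction.pinnedChain ω₂ lam β γ).gibbsMeasure (N + 1) T)) - (∫ z, (z.2 0) ^ 2 ∂((Literature.MathematicalPhysics.KineticTheory.HeatConduction.pinnedChain ω₂ lam β γ).gibbsMeasure (N + 1) T)) * (∫ z, (∫ y, (y.2 j) ^ 2 ∂((Literature.MathematicalPhysics.KineticTheory.HeatConduction.pinnedChain ω₂ lam β γ).transitionKernel (N + 1) T T t.toNNReal z)) ∂((Literature.MathematicalPhysics.KineticTheory.HeatConduction.pinnedChain ω₂ lam β γ).gibbsMeasure (N + 1) T)))) - 1 / 2) - r * ((γ ^ 2 / T ^ 2) * ∫ t in Set.Ioi (0 : ℝ), ((∫ z, (z.2 0) ^ 2 * (∫ y, (y.2 (Fin.last N)) ^ 2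 ∂((Literature.MathematicalPhysics.KineticTheory.HeatConduction.pinnedChain ω₂ lam β γ).transitionKernel (N + 1) T T t.toNNReal z)) ∂((Literature.MathematicalPhysics.KineticTheory.HeatConduction.pinnedChain ω₂ lam β γ).gibbsMeasure (N + 1) T)) - (∫ z, (z.2 0) ^ 2 ∂((Literature.MathematicalPhysics.KineticTheory.HeatConduction.pinnedChain ω₂ lam β γ).gibbsMeasure (N + 1) T)) * (∫ z, (∫ y, (y.2 (Fin.last N)) ^ 2 ∂((Literature.MathematicalPhysics.KineticTheory.HeatConduction.pinnedChain ω₂ lam β γ).transitionKernel (N + 1) T T t.toNNReal z)) ∂((Literature.MathematicalPhysics.KineticTheory.HeatConduction.pinnedChain ω₂ lam β γ).gibbsMeasure (N + 1) T))))| ≤ C * |((γ ^ 2 / T ^ 2) * ∫ t in Set.Ioi (0 : ℝ), ((∫ z, (z.2 0) ^ 2 * (∫ y, (y.2 (Fin.last N)) ^ 2 ∂((Literature.MathematicalPhysics.KineticTheory.HeatConduction.pinnedChain ω₂ lam β γ).transitionKernel (N + 1) T T t.toNNReal z)) ∂((Literature.MathematicalPhysics.KineticTheory.HeatConduction.pinnedChain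 ω₂ lam β γ).gibbsMeasure (N + 1) T)) - (∫ z, (z.2 0) ^ 2 ∂((Literature.MathematicalPhysics.KineticTheory.HeatConduction.pinnedChain ω₂ lam β γ).gibbsMeasure (N + 1) T)) * (∫ z, (∫ y, (y.2 (Fin.last N)) ^ 2 ∂((Literature.MathematicalPhysics.KineticTheory.HeatConduction.pinnedChain ω₂ lam β γ).transitionKernel (N + 1) T T t.toNNReal z)) ∂((Literature.MathematicalPhysics.KineticTheory.HeatConduction.pinnedChain ω₂ lam β γ).gibbsMeasure (N + 1) T))))| * θ ^ N

/-- The split glue IS the landed rider (p126691), by name, against the children as filed. -/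
theorem twoModeBulk_of_filed_children : LayerRelaxationFiled → BulkSlopeFiled →
    Summit.AtomisticToContinuum.FouriersLaw.Theses.PuiseuxTransferLedger.TwoModeBulk :=
  Summit.AtomisticToContinuum.FouriersLaw.Theorems.TwoModeBulk.Sketch.twoModeBulk_of_stubs

end Summit.AtomisticToContinuum.FouriersLaw.Cruxes.TwoModeBulk.StrategistS2

end
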